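import Summits.KontsevichZagierPeriods.KontsevichZagierPeriods.Theses.WeightLine

/-!
# Birth skeleton of crux `WeightLine.TruncationExhaustion` (stmt-KontsevichZagierPeriods-17730)

Piece X2 of the BC2-redirect split of `BackwardVolterraRigidity` (crux-strategist r1, 2026-08-17):
LIMITS only. Two stubs, the proved arrow-form composition `TruncationExhaustion_of_subs` and the skeleton
theorem `TruncationExhaustion_of` (the route decl by name, fed by the stubs by name):
* `stub_topExhaustion` (the `+∞` end): if the level bands `(a, b]` are relations for all large
  rational `b`, the upper truncation at `a` is a relation;
* `stub_levelExhaustion` (the limit at a level from above): if `D(a)` is a relation for all rational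
  `a ∈ (t₀, t₀ + ε)`, then `D(t₀)` is a relation.
Composition: a bound `M` above the finite exceptional set and a gap `(t₀, t₀ + ε)` free of it; for
`a` in the gap the bands `(a, b]`, `b > max M a`, have good ends, so S3 gives `D(a)`, then S4 gives
`D(t₀)`. Both stubs follow from the kernel form of Conjecture 1 (dominated convergence); no move of the
calculus takes such limits. Stub probes (stub → summit / → BVR / → this piece) all fail
(folder bc/TopExhaustion_stubprobe, bc/LevelExhaustion_stubprobe).
-/

noncomputable section

open MeasureTheory Set
open Literature.NumberTheory.Transcendental Literature.NumberTheory.Transcendental.KZ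

namespace Summit.KontsevichZagierPeriods.KontsevichZagierPeriods.Cruxes.TruncationExhaustion.Birth

/-- **S3 · top exhaustion (the `+∞` end).** If the level bands `(a, b]` of the combination are
relations for all sufficiently large rational `b`, then the upper truncation at `a` is a relation.
Values: `V(a) − V(b) = 0` for large `b` and `V(b) → 0`; implied by the kernel form of Conjecture 1;
no move of the calculus passes to this limit. -/
theorem stub_topExhaustion :
    ∀ (J : ℕ) (d : Fin J → ℕ) (k : Fin J → ℤ) (R : (j : Fin J) → Literature.NumberTheory.Transcendental.KZ.IntegralRep (d j + 1)) (a b₀ : ℚ), (∀ b : ℚ, a < b → b₀ < b → ∀ (B : (j : Fin J) → Literature.NumberTheory.Transcendental.KZ.IntegralRep (d j + 1)), (∀ j, (B j).domain = (R j).domain ∩ {z | (a : ℝ) < z (Fin.last (d j)) ∧ z (Fin.last (d j)) ≤ (b : ℝ)} ∧ Set.EqOn (B j).integrand (R j).integrand (B j).domain) → ∑ j, k j • Literature.NumberTheory.Transcendental.KZ.of (B j) ∈ Literature.NumberTheory.Transcendental.KZ.relations) → ∀ (T : (j : Fin J) → Literature.NumberTheory.Transcendental.KZ.IntegralRep (d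 j + 1)), (∀ j, (T j).domain = (R j).domain ∩ {z | (a : ℝ) < z (Fin.last (d j))} ∧ Set.EqOn (T j).integrand (R j).integrand (T j).domain) → ∑ j, k j • Literature.NumberTheory.Transcendental.KZ.of (T j) ∈ Literature.NumberTheory.Transcendental.KZ.relations := by
  sorry

/-- **S4 · level exhaustion (the limit at a level, from above).** If the upper truncations `D(a)` are
relations for all rational `a` in some interval `(t₀, t₀ + ε)`, then `D(t₀)` is a relation.
Values: `V` is continuous (level sets are null); implied by the kernel form of Conjecture 1. -/
theorem stub_levelExhaustion :
    ∀ (J : ℕ) (d : Fin J → ℕ) (k : Fin J → ℤ) (R : (j : Fin J) → Literature.NumberTheory.Transcendental.KZ.IntegralRep (d j + 1)) (t₀ ε : ℚ), 0 < ε → (∀ a : ℚ, t₀ < a → a < t₀ + ε → ∀ (T : (j : Fin J) → Literature.NumberTheory.Transcendental.KZ.IntegralRep (d j + 1)), (∀ j, (T j).domain = (R j).domain ∩ {z | (a : ℝ) < z (Fin.last (d j))} ∧ Set.EqOn (T j).integrand (R j).integrand (T j).domain) → ∑ j, k j • Literature.NumberTheory.Transcendental.KZ.of (T j) ∈ Literature.NumberTheory.Transcendental.KZ.relations)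 → ∀ (T : (j : Fin J) → Literature.NumberTheory.Transcendental.KZ.IntegralRep (d j + 1)), (∀ j, (T j).domain = (R j).domain ∩ {z | (t₀ : ℝ) < z (Fin.last (d j))} ∧ Set.EqOn (T j).integrand (R j).integrand (T j).domain) → ∑ j, k j • Literature.NumberTheory.Transcendental.KZ.of (T j) ∈ Literature.NumberTheory.Transcendental.KZ.relations := by
  sorry

/-- Above every element of a finite set of levels. [folklore] -/
theorem exists_forall_mem_lt (F : Finset ℚ) : ∃ M : ℚ, ∀ f ∈ F, f ≤ M := by
  obtain ⟨M, hM⟩ := F.bddAbove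
  exact ⟨M, fun f hf => hM (Finset.mem_coe.mpr hf)⟩

/-- A gap above a level free of a finite set of levels. [folklore] -/
theorem exists_gap_above (F : Finset ℚ) (t₀ : ℚ) :
    ∃ ε : ℚ, 0 < ε ∧ ∀ f ∈ F, t₀ < f → t₀ + ε ≤ f := by
  classical
  by_cases hG : (F.filter fun f => t₀ < f).Nonempty
  · refine ⟨(F.filter fun f => t₀ < f).min' hG - t₀, ?_, ?_⟩
    · have hmem := Finset.min'_mem _ hG
      have hlt : t₀ < (F.filter fun f => t₀ < f).min' hG := (Finset.mem_filter.mp hmem).2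
      linarith
    · intro f hf hlt
      have hle : (F.filter fun f => t₀ < f).min' hG ≤ f :=
        Finset.min'_le _ _ (Finset.mem_filter.mpr ⟨hf, hlt⟩)
      linarith
  · exact ⟨1, one_pos, fun f hf hlt => absurd ⟨f, Finset.mem_filter.mpr ⟨hf, hlt⟩⟩ hG⟩


/-- **Piece 2 from its two stubs.** `TruncationExhaustion` from `stub_topExhaustion` (S3) and
`stub_levelExhaustion` (S4): choose a gap `(t₀, t₀ + ε)` free of exceptional levels and a bound `M`
above them; for `a` in the gap every band `(a, b]` with `b > max M a` has both ends good, so S3 gives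
`D(a) ∈ relations`; then S4 gives `D(t₀) ∈ relations`. [cite: KontsevichZagier2001, §1.2] -/
theorem TruncationExhaustion_of_subs
    (h₃ : ∀ (J : ℕ) (d : Fin J → ℕ) (k : Fin J → ℤ) (R : (j : Fin J) → Literature.NumberTheory.Transcendental.KZ.IntegralRep (d j + 1)) (a b₀ : ℚ), (∀ b : ℚ, a < b → b₀ < b → ∀ (B : (j : Fin J) → Literature.NumberTheory.Transcendental.KZ.IntegralRep (d j + 1)), (∀ j, (B j).domain = (R j).domain ∩ {z | (a : ℝ) < z (Fin.last (d j)) ∧ z (Fin.last (d j)) ≤ (b : ℝ)} ∧ Set.EqOn (B j).integrand (R j).integrand (B j).domain) → ∑ j, k j • Literature.NumberTheory.Transcendental.KZ.of (B j) ∈ Literature.NumberTheory.Transcendental.KZ.relations) → ∀ (T : (j : Fin J) → Literature.NumberTheory.Transcendental.KZ.IntegralRep (d j + 1)), (∀ j, (T j).domain = (R j).domain ∩ {z | (a : ℝ) < z (Fin.last (d j))} ∧ Set.EqOn (T j).integrand (R j).integrand (T j).domain) → ∑ j, k j • Literature.NumberTheory.Transcendental.KZ.of (T j) ∈ Literatu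re.NumberTheory.Transcendental.KZ.relations)
    (h₄ : ∀ (J : ℕ) (d : Fin J → ℕ) (k : Fin J → ℤ) (R : (j : Fin J) → Literature.NumberTheory.Transcendental.KZ.IntegralRep (d j + 1)) (t₀ ε : ℚ), 0 < ε → (∀ a : ℚ, t₀ < a → a < t₀ + ε → ∀ (T : (j : Fin J) → Literature.NumberTheory.Transcendental.KZ.IntegralRep (d j + 1)), (∀ j, (T j).domain = (R j).domain ∩ {z | (a : ℝ) < z (Fin.last (d j))} ∧ Set.EqOn (T j).integrand (R j).integrand (T j).domain) → ∑ j, k j • Literature.NumberTheory.Transcendental.KZ.of (T j) ∈ Literature.NumberTheory.Transcendental.KZ.relations) → ∀ (T : (j : Fin J) → Literature.NumberTheory.Transcendental.KZ.IntegralRep (d j + 1)), (∀ j, (T j).domain = (R j).domain ∩ {z | (t₀ : ℝ) < z (Fin.last (d j))} ∧ Set.EqOn (T j).integrand (R j).integrand (T j).domain) → ∑ j, k j • Literature.NumberTheory.Transcendental.KZ.of (T j) ∈ Literature.NumberTheory.Transcendental.KZ.relations) :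
    ∀ (J : ℕ) (d : Fin J → ℕ) (k : Fin J → ℤ) (R : (j : Fin J) → Literature.NumberTheory.Transcendental.KZ.IntegralRep (d j + 1)) (t₀ : ℚ) (F : Finset ℚ), (∀ a b : ℚ, t₀ < a → a < b → a ∉ F → b ∉ F → ∀ (B : (j : Fin J) → Literature.NumberTheory.Transcendental.KZ.IntegralRep (d j + 1)), (∀ j, (B j).domain = (R j).domain ∩ {z | (a : ℝ) < z (Fin.last (d j)) ∧ z (Fin.last (d j)) ≤ (b : ℝ)} ∧ Set.EqOn (B j).integrand (R j).integrand (B j).domain) → ∑ j, k j • Literature.NumberTheory.Transcendental.KZ.of (B j) ∈ Literature.NumberTheory.Transcendental.KZ.relations) → ∀ (T : (j : Fin J) → Literature.NumberTheory.Transcendental.KZ.IntegralRep (d j + 1)), (∀ j, (T j).domain = (R j).domain ∩ {z | (t₀ : ℝ) < z (Fin.last (d j))} ∧ Set.EqOn (T j).integrand (R j).integrand (T j).domain) → ∑ j, k j • Literature.NumberTheory.Transcendental.KZ.of (T j) ∈ Literature.NumberTheory.Transcendental.KZ.relations := by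
  intro J d k R t₀ F hBand T hT
  obtain ⟨M, hM⟩ := exists_forall_mem_lt F
  obtain ⟨ε, hε, hgap⟩ := exists_gap_above F t₀
  refine h₄ J d k R t₀ ε hε (fun a hta haε Ta hTa => ?_) T hT
  have haF : a ∉ F := fun haF => by
    have := hgap a haF hta
    linarith
  refine h₃ J d k R a (max M a) (fun b hab hMb B hB => hBand a b hta hab haF ?_ B hB) Ta hTa
  intro hbF
  have h1 : b ≤ M := hM b hbF
  have h2 : M ≤ max M a := le_max_left M a
  linarith

/-- **Skeleton theorem** (concludes the crux BY NAME): `WeightLine.TruncationExhaustion` from the two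
declared stubs, through the sorry-free arrow-form composition `TruncationExhaustion_of_subs`. -/
theorem TruncationExhaustion_of : Summit.KontsevichZagierPeriods.KontsevichZagierPeriods.Theses.WeightLine.TruncationExhaustion :=
  TruncationExhaustion_of_subs stub_topExhaustion stub_levelExhaustion

end Summit.KontsevichZagierPeriods.KontsevichZagierPeriods.Cruxes.TruncationExhaustion.Birth

end
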